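import Mathlib.Analysis.Convex.Deriv
import Mathlib.Analysis.Calculus.Deriv.Slope
import Mathlib.Topology.Algebra.Order.LiminfLimsup
import HarnessLib

/-!
# Derivatives of pointwise limits of convex functions (Griffiths' lemma)

If differentiable convex functions `f N : ℝ → ℝ` converge pointwise to `g` and `g` is differentiable
at `t₀`, then `deriv (f N) t₀ → deriv g t₀` (Griffiths 1964; Ruelle, *Statistical Mechanics* (1969),
§5.4; Simon, *The Statistical Mechanics of Lattice Gases* I (1993), "Griffiths' lemma"). In
statistical mechanics this is the statement that a finite-volume expectation `P_N'(t)` (derivative of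
the convex finite-volume pressure) converges to the derivative of the infinite-volume pressure at
every point where the latter is differentiable — in particular everywhere on an interval of
analyticity; it is the only correlation information that pointwise convergence of pressures carries
(second derivatives need not converge). The proof is the two secant inequalities of a differentiable
convex function, `slope (f N) (t₀ - h) t₀ ≤ (f N)' t₀ ≤ slope (f N) t₀ (t₀ + h)`, passage to the
limit `N → ∞` at fixed `h`, then `h → 0⁺`.
-/

namespace Literature.Analysis.Convex

open Filter Set Topology

/-- **Griffiths' lemma.** Pointwise limits of differentiable convex functions on `ℝ`: at every point
where the limit is differentiable, the derivatives converge to the derivative of the limit.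
[cite: Ruelle1969, §5.4 (Griffiths' lemma)] -/
theorem tendsto_deriv_of_convexOn_of_tendsto {f : ℕ → ℝ → ℝ} {g : ℝ → ℝ}
    (hfc : ∀ N, ConvexOn ℝ univ (f N)) (hfd : ∀ N, Differentiable ℝ (f N))
    (hlim : ∀ t, Tendsto (fun N => f N t) atTop (𝓝 (g t))) {t₀ : ℝ}
    (hg : DifferentiableAt ℝ g t₀) :
    Tendsto (fun N => deriv (f N) t₀) atTop (𝓝 (deriv g t₀)) := by
  have hslope : ∀ h : ℝ, Tendsto (fun N => h⁻¹ • (f N (t₀ + h) - f N t₀)) atTop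
      (𝓝 (h⁻¹ • (g (t₀ + h) - g t₀))) := fun h =>
    ((hlim (t₀ + h)).sub (hlim t₀)).const_smul h⁻¹
  have hR := hg.hasDerivAt.tendsto_slope_zero_right
  have hL := hg.hasDerivAt.tendsto_slope_zero_left
  rw [tendsto_order]
  constructor
  · -- lower bound: `deriv g t₀ - ε < deriv (f N) t₀` eventually, through a left secant
    intro a ha
    obtain ⟨h, hh, hneg⟩ : ∃ h : ℝ, a < h⁻¹ • (g (t₀ + h) - g t₀) ∧ h < 0 := by
      have hev : ∀ᶠ h in 𝓝[<] (0 : ℝ), a < h⁻¹ • (g (t₀ + h) - g t₀) := hL (Ioi_mem_nhds ha)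
      exact (hev.and self_mem_nhdsWithin).exists
    have hev : ∀ᶠ N in atTop, a < h⁻¹ • (f N (t₀ + h) - f N t₀) := hslope h (Ioi_mem_nhds hh)
    refine hev.mono fun N hN => lt_of_lt_of_le hN ?_
    have hsl : h⁻¹ • (f N (t₀ + h) - f N t₀) = slope (f N) (t₀ + h) t₀ := by
      rw [slope_def_field, smul_eq_mul, show t₀ - (t₀ + h) = -h by ring, div_neg, ← neg_div, neg_sub,
        div_eq_inv_mul]
    rw [hsl]
    exact (hfc N).slope_le_deriv (mem_univ _) (mem_univ _) (by linarith) ((hfd N) t₀)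
  · -- upper bound: `deriv (f N) t₀ < deriv g t₀ + ε` eventually, through a right secant
    intro b hb
    obtain ⟨h, hh, hpos⟩ : ∃ h : ℝ, h⁻¹ • (g (t₀ + h) - g t₀) < b ∧ 0 < h := by
      have hev : ∀ᶠ h in 𝓝[>] (0 : ℝ), h⁻¹ • (g (t₀ + h) - g t₀) < b := hR (Iio_mem_nhds hb)
      exact (hev.and self_mem_nhdsWithin).exists
    have hev : ∀ᶠ N in atTop, h⁻¹ • (f N (t₀ + h) - f N t₀) < b := hslope h (Iio_mem_nhds hh)
    refine hev.mono fun N hN => lt_of_le_of_lt ?_ hN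
    have hsl : h⁻¹ • (f N (t₀ + h) - f N t₀) = slope (f N) t₀ (t₀ + h) := by
      rw [slope_def_field, smul_eq_mul, show t₀ + h - t₀ = h by ring, div_eq_inv_mul]
    rw [hsl]
    exact (hfc N).deriv_le_slope (mem_univ _) (mem_univ _) (by linarith) ((hfd N) t₀)

end Literature.Analysis.Convex
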